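import Summits.Parity.BatemanHorn.Theses.AlmostPrimeZeros
import Summits.Parity.BatemanHorn.Theorems.SystemLSDRealSegment.Negative.FinZero
import Summits.Parity.BatemanHorn.Theorems.SystemLSDRealSegment.Negative.Engines
import Summits.Parity.BatemanHorn.Theorems.SystemLSDRealSegment.Negative.LoadBearing
import Summits.Parity.BatemanHorn.Theorems.SystemLSDRealSegment.Negative.Structure

/-!
# Line `sign-free-sieve-lab` for the crux `AlmostPrimeZeros.SystemLSDRealSegment` (stmt-Parity-11292)

Crux-plan skeleton (planner-cruxplan-stmt-Parity-11292-sign-free-sieve-lab-0, 2026-08-16).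
Card: `Cruxes/SystemLSDRealSegment/Ideas/sign-free-sieve-lab.md`; line card `Lines/sign-free-sieve-lab.md`.

THE LINE (sign-free asymptotic sieve, squeezed by level). With the thinning weight `h_y`
(`h_y(p) = y - 1`, `h_y(p²) = y² - y`, `h_y(p^v) = 0` for `v ≥ 3`; `h_y ≥ 0` for `y ≥ 1`) one has the exact
divisor expansion `y^{s_f(n)} = Σ_{d_i ∣ f_i(n)} ∏_i h_y(d_i)` (every `f_i(n) > 0`), i.e. the crux's sum is the
total mass of a POSITIVE measure on divisor tuples. Cut it at total level `x^θ` (`∏ d_i ≤ x^θ`,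
`0 < θ < T := Σ_i deg f_i`):

* `stub_sliceMinorant` — every slice is a minorant (divisor expansion + positivity) [provable now, M];
* `stub_eulerFactor` — the ordered Euler product `∏_p E_p(y)(1-1/p)^{k(y-1)}` (local means `E_p` over
  `ℤ/p²`) converges on the segment to the restriction of a `Λ` holomorphic on `|z| < 2` with `Λ 0 = C(f)`
  (bookkeeping: `E_p(0) = 1 - ω_f(p)/p`, AZFG2020 convergence) [provable with work, M/L];
* `stub_slicedKernel` — THE OPEN STUB (the card's Transfer `RoughAnatomy` in divisor currency = the anatomy
  object every round-1 card isolates, cut BELOW the top slice): for `k ≥ 1` the normalised level-`θ` slice tends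
  to `Λ(y)·G(θ)` for every `θ ∈ (0, T)`, for a profile `G` with `G(θ) → D^{y-1}Γ(y)^{-k}` as `θ → T⁻`
  (model: `G(θ) = Γ(y)^{-k} D^{y-1} P(Σ_i deg f_i · B_i ≤ θ)`, `B_i` iid Beta(`y-1`,1); `θ ≤ 1` is Type-I +
  Wirsing, theorem-grade; `θ ∈ (1, T)` is root equidistribution of `∏ f_i` modulo structured moduli beyond `x`);
* `stub_topSliceTail` — the top slices are priced `≤ ε`: tuples with `∏ d_i > x^θ`, `θ → T⁻`, i.e. all
  cofactors `∏ f_i(n)/d_i < x^{T-θ}` (Nair–Tenenbaum/Henriot upper bound with the thinning factor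
  `((y-1)/y)^{#large primes}`; model share `≈ (T-θ)/T`) [provable with work, L];
* `conclusion_of_stubs` (hypothesis form) and `SystemLSDRealSegment_of : SystemLSDRealSegment` (by name) — the
  kernel-checked composition: squeeze in `θ` (real analysis), the `k = 0` branch from the landed `Negative.FinZero`,
  real → complex through `Negative.normSum_eq_ofReal`.

Disproof gen 2 honoured: `false_without_leadingCoeff_pos` (toNat convention inherited verbatim; values `≤ 0`
give empty divisor tuples, so `stub_sliceMinorant` holds termwise), `false_without_irreducible` /
`false_without_pairwise_not_associated` (they enter `stub_slicedKernel`/`stub_eulerFactor` through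
`IsBatemanHornSystem`: prime-ideal-theorem mean `1` of `ρ_{f_i}` and finitely many common primes — the
witnesses `![X^2]`, `![X,X]` break exactly the profile/normalisation there), `conclusion_fin_zero` (used, not
re-proved: `Negative.systemLSDRealSegment_fin_zero`), `eqOn_ball_of_eqOn_segment`/`Λ_unique` (the line PRODUCES
`Λ = λ_f` via `stub_eulerFactor`; no `∃Λ`-slack), `not_omegaLawWide` (cap ⇒ `h_y(p^v) = 0`, `v ≥ 3`; the line
never leaves `y < 2`). No stub is an instance of a landed `Negative/*` refutation (imported above and checked).
-/

open Filter Polynomial Finset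
open scoped Topology BigOperators

namespace Summit.Parity.BatemanHorn.Cruxes.SystemLSDRealSegment.SignFreeSieveLab

open Literature.NumberTheory.Sieve
open Summit.Parity.BatemanHorn.Theses.AlmostPrimeZeros
open Summit.Parity.BatemanHorn.Theorems.SystemLSDRealSegment

noncomputable section

/-! ## The objects (all are abbreviations of sub-terms of the crux, plus the thinned slices) -/

/-- The capped almost-prime statistic `s_f(n) = Σ_i Σ_{p^v ∥ f_i(n)} min(v,2)`, verbatim as in the crux. -/
def stat {k : ℕ} (f : Fin k → ℤ[X]) (n : ℕ) : ℕ :=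
  ∑ i, (((f i).eval (n : ℤ)).toNat.factorization.sum fun _ v => min v 2)

/-- The crux's normalised sum, real form: `x⁻¹ e^{k(1-y) log log x} Σ_{n ≤ x} y^{s_f(n)}`. -/
def normSum (k : ℕ) (f : Fin k → ℤ[X]) (y : ℝ) (x : ℕ) : ℝ :=
  (x : ℝ)⁻¹ * Real.exp (k * (1 - y) * Real.log (Real.log x)) * ∑ n ∈ Finset.range (x + 1), y ^ stat f n

/-- The thinning weight `h_y` (Möbius transform of `m ↦ y^{s(m)}`): multiplicative, `h_y(p) = y - 1`,
`h_y(p²) = y² - y`, `h_y(p^v) = 0` for `v ≥ 3`. -/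
def thinWeight (y : ℝ) (d : ℕ) : ℝ :=
  d.factorization.prod fun _ v => if v = 1 then y - 1 else if v = 2 then y ^ 2 - y else 0

/-- Total degree `T = Σ_i deg f_i` (the range of the level parameter `θ`). -/
def totalDegree {k : ℕ} (f : Fin k → ℤ[X]) : ℝ := ∑ i, ((f i).natDegree : ℝ)

/-- The archimedean factor `D^{y-1} Γ(y)^{-k}`, `D = ∏ deg f_i`, of the crux's limit (real form). -/
def archFactor (k : ℕ) (f : Fin k → ℤ[X]) (y : ℝ) : ℝ :=
  Real.exp ((y - 1) * Real.log (∏ i, ((f i).natDegree : ℝ))) * (Real.Gamma y)⁻¹ ^ k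

/-- The level-`θ` SLICE of the thinned divisor-tuple expansion:
`Σ_{n ≤ x} Σ_{(d_i), d_i ∣ f_i(n), ∏ d_i ≤ x^θ} ∏_i h_y(d_i)` (tuples of divisors of the positive values;
an `f_i(n) ≤ 0` has no divisors under `Int.toNat`, `Nat.divisors 0 = ∅`). -/
def sliceSum (k : ℕ) (f : Fin k → ℤ[X]) (y θ : ℝ) (x : ℕ) : ℝ :=
  ∑ n ∈ Finset.range (x + 1),
    ∑ d ∈ Fintype.piFinset (fun i => (((f i).eval (n : ℤ)).toNat).divisors),
      if (∏ i, ((d i : ℕ) : ℝ)) ≤ (x : ℝ) ^ θ then ∏ i, thinWeight y (d i) else 0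

/-- The normalised slice `x⁻¹ e^{k(1-y) log log x} · sliceSum`. -/
def normSlice (k : ℕ) (f : Fin k → ℤ[X]) (y θ : ℝ) (x : ℕ) : ℝ :=
  (x : ℝ)⁻¹ * Real.exp (k * (1 - y) * Real.log (Real.log x)) * sliceSum k f y θ x

/-- Local capped valuation pattern of the residue `r` at the prime `p`: `Σ_i min(v_p(f_i(r)), 2)`, read off
`r mod p²`. -/
def capAt {k : ℕ} (f : Fin k → ℤ[X]) (p r : ℕ) : ℕ :=
  ∑ i, (if ((p : ℤ) ^ 2 ∣ (f i).eval (r : ℤ)) then 2 else if ((p : ℤ) ∣ (f i).eval (r : ℤ)) then 1 else 0)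

/-- The local mean `E_p(y) = p⁻² Σ_{r mod p²} y^{capAt}` — a polynomial in `y` of degree `≤ 2k` with
`E_p(0) = 1 - ω_f(p)/p` and `E_p(1) = 1`. -/
def localFactor {k : ℕ} (f : Fin k → ℤ[X]) (y : ℝ) (p : ℕ) : ℝ :=
  ((p : ℝ) ^ 2)⁻¹ * ∑ r ∈ Finset.range (p ^ 2), y ^ capAt f p r

/-- The ordered partial Euler product `∏_{p ≤ P} E_p(y) (1 - 1/p)^{k(y-1)}` of `λ_f(y)` (at `y = 0` it is
`batemanHornPartial f P`). -/
def eulerPartial (k : ℕ) (f : Fin k → ℤ[X]) (y : ℝ) (P : ℕ) : ℝ :=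
  ∏ p ∈ Nat.primesLE P, localFactor f y p * (1 - 1 / (p : ℝ)) ^ ((k : ℝ) * (y - 1))

/-! ## The registered stubs -/

/-- STUB 1 (provable now, size M) — SLICE MINORANT: every level-`θ` slice of the thinned divisor-tuple expansion
is a lower bound for the crux's sum, because `y^{s(m)} = Σ_{d ∣ m} h_y(d)` exactly for `m ≥ 1` (multiplicativity;
the cap makes `Σ_{j ≤ v} h_y(p^j) = y^{min(v,2)}`) and `h_y ≥ 0` for `y ≥ 1`; an `n` with some `f_i(n) ≤ 0`
contributes `0 ≤ y^{s}`. -/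
theorem stub_sliceMinorant :
    ∀ (k : ℕ) (f : Fin k → ℤ[X]) (y θ : ℝ), 1 ≤ y → ∀ x : ℕ, normSlice k f y θ x ≤ normSum k f y x := by
  sorry

/-- STUB 2 (provable with work, size M/L) — EULER FACTOR: for a Bateman–Horn system the ordered Euler product
`∏_p E_p(y)(1-1/p)^{k(y-1)}` converges at every `y` of the segment to the (real) value of a function `Λ = λ_f`
holomorphic on `|z| < 2` (indeed entire: `log E_p(z) + k(z-1)log(1-1/p) = (z-1)(ω_f(p)-k)/p + O(p^{-2})`
locally uniformly, and `Σ_p (ω_f(p)-k)/p` converges by `AZFG2020_tendsto_sum_sub_omega_div_holds`), whose value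
at `0` is `C(f)` (`E_p(0) = 1 - ω_f(p)/p`, so the partial product at `0` IS `batemanHornPartial f P`, and
`IsBatemanHornSystem.hasBatemanHornConst_holds`). -/
theorem stub_eulerFactor :
    ∀ (k : ℕ) (f : Fin k → ℤ[X]), IsBatemanHornSystem f →
      ∃ Λ : ℂ → ℂ, DifferentiableOn ℂ Λ (Metric.ball 0 2) ∧ Λ 0 = (batemanHornConst f : ℂ) ∧
        ∀ y : ℝ, 5 / 4 < y → y < 7 / 4 →
          (Λ y).im = 0 ∧ Tendsto (eulerPartial k f y) atTop (𝓝 (Λ y).re) := by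
  sorry

/-- STUB 3 (OPEN — the hardest stub; the card's Transfer `RoughAnatomy` in divisor currency, cut below the top
slice) — SLICED KERNEL: for a Bateman–Horn system with `k ≥ 1` and `y` on the segment there is a profile `G`
with `G(θ) → D^{y-1}Γ(y)^{-k}` as `θ → T⁻` such that for EVERY level `θ ∈ (0, T)` the normalised slice tends
to `Λ(y)·G(θ)` (`Λ(y)` = the Euler limit of STUB 2, passed as the hypothesis `L`).
Model: `G(θ) = Γ(y)^{-k} D^{y-1} · P(Σ_i deg f_i · B_i ≤ θ)`, `B_i` iid Beta(`y-1`, 1) (`k = 1`: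
`G(θ) = θ^{y-1}/Γ(y)`; twins at `θ = 1`: `Γ(2y-1)^{-1}`). Range `θ ≤ 1`: complete periods (CRT) + a Wirsing /
Halberstam–Richert-5.4 mean value for `∏ h_y(d_i) ρ(d⃗)` — theorem-grade, first milestone. Range `θ ∈ (1, T)`:
equidistribution in `[0, x]` of the root tuples of `(f_i)` modulo `(d_i)` with `x < ∏ d_i ≤ x^θ`, weighted by
`∏ h_y(d_i) ≥ 0` — open (`θ ≤ 1 + δ` for quadratics: DFI/Tóth/de la Bretèche–Drappeau; sub-critical for every
`θ < 2` when `T = 2`; super-critical slices exist when `T ≥ 3`). -/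
theorem stub_slicedKernel :
    ∀ (k : ℕ) (f : Fin k → ℤ[X]), IsBatemanHornSystem f → 1 ≤ k →
      ∀ y : ℝ, 5 / 4 < y → y < 7 / 4 →
        ∃ G : ℝ → ℝ, Tendsto G (𝓝[<] totalDegree f) (𝓝 (archFactor k f y)) ∧
          ∀ θ : ℝ, 0 < θ → θ < totalDegree f →
            ∀ L : ℝ, Tendsto (eulerPartial k f y) atTop (𝓝 L) →
              Tendsto (normSlice k f y θ) atTop (𝓝 (L * G θ)) := by
  sorry

/-- STUB 4 (provable with work, size L) — TOP-SLICE TAIL: for a Bateman–Horn system with `k ≥ 1`, `y` on the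
segment and `ε > 0` there is a level `θ₀ ∈ [0, T)` beyond which the slices already exhaust the normalised sum
up to `ε`, eventually in `x`. Tuples with `∏ d_i > x^θ`, `θ > T - η`, have ALL cofactors small,
`∏_i f_i(n)/d_i < c_f x^η`; writing `f_i(n) = a·b` (`x^η`-smooth / rough parts) the tail is
`≈ Σ_n y^{s(a_n)} h_y(b_n)`, an upper-bound-sieve quantity (Nair–Tenenbaum 1998 / Henriot 2012 class, no
asymptotics, no parity) of relative size `E_tilt[((y-1)/y)^{#{p ∣ ∏f_i(n) : p > x^η}}] ≍ η`; the finitely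
many `n` with some `f_i(n) ≤ 0` add `O(x⁻¹)`. -/
theorem stub_topSliceTail :
    ∀ (k : ℕ) (f : Fin k → ℤ[X]), IsBatemanHornSystem f → 1 ≤ k →
      ∀ y : ℝ, 5 / 4 < y → y < 7 / 4 → ∀ ε : ℝ, 0 < ε →
        ∃ θ₀ : ℝ, 0 ≤ θ₀ ∧ θ₀ < totalDegree f ∧
          ∀ θ : ℝ, θ₀ < θ → θ < totalDegree f →
            ∀ᶠ x : ℕ in atTop, normSum k f y x - normSlice k f y θ x ≤ ε := by
  sorry

/-! ## Glue (sorry-free) -/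

/-- The squeeze in the level: minorant slices with limits `L·G(θ)`, `G(θ) → A` as `θ → T⁻`, and top-slice
tails `≤ ε` force `u → L·A`. Pure real analysis. -/
theorem tendsto_of_slices {u : ℕ → ℝ} {v : ℝ → ℕ → ℝ} {G : ℝ → ℝ} {T L A : ℝ}
    (hmin : ∀ θ x, v θ x ≤ u x)
    (hG : Tendsto G (𝓝[<] T) (𝓝 A))
    (hv : ∀ θ, 0 < θ → θ < T → Tendsto (v θ) atTop (𝓝 (L * G θ)))
    (htail : ∀ ε : ℝ, 0 < ε → ∃ θ₀ : ℝ, 0 ≤ θ₀ ∧ θ₀ < T ∧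
      ∀ θ, θ₀ < θ → θ < T → ∀ᶠ x : ℕ in atTop, u x - v θ x ≤ ε) :
    Tendsto u atTop (𝓝 (L * A)) := by
  have hLG : Tendsto (fun θ => L * G θ) (𝓝[<] T) (𝓝 (L * A)) := hG.const_mul L
  rw [tendsto_order]
  constructor
  · intro a ha
    obtain ⟨θ₀, hθ₀, hθ₀T, -⟩ := htail 1 one_pos
    have h1 : ∀ᶠ θ in 𝓝[<] T, a < L * G θ := hLG.eventually (lt_mem_nhds ha)
    have h2 : ∀ᶠ θ in 𝓝[<] T, θ ∈ Set.Ioo θ₀ T := Ioo_mem_nhdsLT hθ₀T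
    obtain ⟨θ, hθa, hθ0, hθT⟩ := (h1.and h2).exists
    have h3 : ∀ᶠ x in atTop, a < v θ x := (hv θ (by linarith) hθT).eventually (lt_mem_nhds hθa)
    exact h3.mono fun x hx => lt_of_lt_of_le hx (hmin θ x)
  · intro b hb
    set ε : ℝ := (b - L * A) / 3 with hε
    have hε0 : 0 < ε := by rw [hε]; linarith
    obtain ⟨θ₀, hθ₀, hθ₀T, hθ⟩ := htail ε hε0
    have h1 : ∀ᶠ θ in 𝓝[<] T, L * G θ < L * A + ε := hLG.eventually (gt_mem_nhds (by linarith))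
    have h2 : ∀ᶠ θ in 𝓝[<] T, θ ∈ Set.Ioo θ₀ T := Ioo_mem_nhdsLT hθ₀T
    obtain ⟨θ, hθa, hθ0, hθT⟩ := (h1.and h2).exists
    have h3 : ∀ᶠ x in atTop, v θ x < L * G θ + ε :=
      (hv θ (by linarith) hθT).eventually (gt_mem_nhds (by linarith))
    filter_upwards [h3, hθ θ hθ0 hθT] with x hx hx'
    linarith

/-- The complex archimedean factor of the crux is the real `archFactor` coerced. -/
theorem archFactor_ofReal (k : ℕ) (f : Fin k → ℤ[X]) (y : ℝ) :
    Complex.exp (((y : ℂ) - 1) * (Real.log (∏ i, ((f i).natDegree : ℝ)) : ℂ)) * (Complex.Gamma y)⁻¹ ^ k =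
      ((archFactor k f y : ℝ) : ℂ) := by
  rw [archFactor, Complex.Gamma_ofReal]
  push_cast
  ring

/-- A complex number with zero imaginary part is its real part coerced. -/
theorem eq_ofReal_re_of_im_eq_zero {z : ℂ} (hz : z.im = 0) : z = ((z.re : ℝ) : ℂ) := by
  apply Complex.ext <;> simp [hz]

/-- THE COMPOSITION, hypothesis form (kernel-checked, no `sorry`): the four stub STATEMENTS, taken as hypotheses,
give the conclusion of the crux (its body, verbatim) for every Bateman–Horn system. -/
theorem conclusion_of_stubs :
    (∀ (k : ℕ) (f : Fin k → ℤ[X]) (y θ : ℝ), 1 ≤ y → ∀ x : ℕ, normSlice k f y θ x ≤ normSum k f y x) →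
    (∀ (k : ℕ) (f : Fin k → ℤ[X]), IsBatemanHornSystem f →
      ∃ Λ : ℂ → ℂ, DifferentiableOn ℂ Λ (Metric.ball 0 2) ∧ Λ 0 = (batemanHornConst f : ℂ) ∧
        ∀ y : ℝ, 5 / 4 < y → y < 7 / 4 →
          (Λ y).im = 0 ∧ Tendsto (eulerPartial k f y) atTop (𝓝 (Λ y).re)) →
    (∀ (k : ℕ) (f : Fin k → ℤ[X]), IsBatemanHornSystem f → 1 ≤ k →
      ∀ y : ℝ, 5 / 4 < y → y < 7 / 4 →
        ∃ G : ℝ → ℝ, Tendsto G (𝓝[<] totalDegree f) (𝓝 (archFactor k f y)) ∧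
          ∀ θ : ℝ, 0 < θ → θ < totalDegree f →
            ∀ L : ℝ, Tendsto (eulerPartial k f y) atTop (𝓝 L) →
              Tendsto (normSlice k f y θ) atTop (𝓝 (L * G θ))) →
    (∀ (k : ℕ) (f : Fin k → ℤ[X]), IsBatemanHornSystem f → 1 ≤ k →
      ∀ y : ℝ, 5 / 4 < y → y < 7 / 4 → ∀ ε : ℝ, 0 < ε →
        ∃ θ₀ : ℝ, 0 ≤ θ₀ ∧ θ₀ < totalDegree f ∧
          ∀ θ : ℝ, θ₀ < θ → θ < totalDegree f →
            ∀ᶠ x : ℕ in atTop, normSum k f y x - normSlice k f y θ x ≤ ε) →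
    ∀ (k : ℕ) (f : Fin k → ℤ[X]), IsBatemanHornSystem f →
      ∃ Λ : ℂ → ℂ, DifferentiableOn ℂ Λ (Metric.ball 0 2) ∧ Λ 0 = (batemanHornConst f : ℂ) ∧
        ∀ y : ℝ, 5 / 4 < y → y < 7 / 4 → Filter.Tendsto (fun x : ℕ => (x : ℂ)⁻¹ *
          Complex.exp ((k : ℂ) * (1 - (y : ℂ)) * (Real.log (Real.log x) : ℂ)) *
          ∑ n ∈ Finset.range (x + 1), (y : ℂ) ^ (∑ i, (((f i).eval (n : ℤ)).toNat.factorization.sum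
            fun _ v => min v 2))) Filter.atTop (nhds (Λ y * Complex.exp (((y : ℂ) - 1) *
            (Real.log (∏ i, ((f i).natDegree : ℝ)) : ℂ)) * (Complex.Gamma y)⁻¹ ^ k)) := by
  intro h1 h2 h3 h4 k f hf
  rcases Nat.eq_zero_or_pos k with rfl | hk
  · exact Negative.systemLSDRealSegment_fin_zero f hf
  obtain ⟨Λ, hΛd, hΛ0, hΛ⟩ := h2 k f hf
  refine ⟨Λ, hΛd, hΛ0, fun y hy hy' => ?_⟩
  obtain ⟨him, hlim⟩ := hΛ y hy hy'
  obtain ⟨G, hG, hsl⟩ := h3 k f hf hk y hy hy'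
  have hreal : Tendsto (normSum k f y) atTop (𝓝 ((Λ y).re * archFactor k f y)) :=
    tendsto_of_slices (v := fun θ x => normSlice k f y θ x) (fun θ x => h1 k f y θ (by linarith) x) hG
      (fun θ h0 hT => hsl θ h0 hT _ hlim) (h4 k f hf hk y hy hy')
  have hC := Negative.tendsto_ofReal_of_tendsto hreal
  have htarget : Λ y * Complex.exp (((y : ℂ) - 1) * (Real.log (∏ i, ((f i).natDegree : ℝ)) : ℂ)) *
      (Complex.Gamma y)⁻¹ ^ k = ((((Λ y).re * archFactor k f y : ℝ)) : ℂ) := by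
    rw [mul_assoc, archFactor_ofReal, eq_ofReal_re_of_im_eq_zero him]
    push_cast
    simp
  rw [htarget]
  refine hC.congr fun x => ?_
  rw [Negative.normSum_eq_ofReal k f y x]
  rfl

/-- THE COMPOSITION concluding the crux `Summit.Parity.BatemanHorn.Theses.AlmostPrimeZeros.SystemLSDRealSegment`
BY NAME (no `sorry` of its own; the only `sorry`s in its cone are the four registered stubs'). -/
theorem SystemLSDRealSegment_of : SystemLSDRealSegment :=
  conclusion_of_stubs stub_sliceMinorant stub_eulerFactor stub_slicedKernel stub_topSliceTail

end

end Summit.Parity.BatemanHorn.Cruxes.SystemLSDRealSegment.SignFreeSieveLab
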